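import Summits.NavierStokesRegularity.FluidComputer.ClayBlowupForcedL3
import Summits.NavierStokesRegularity.FluidComputer.ClayBlowupForcedAxisymTypeI
import HarnessLib

/-!
# THE ZOOM PORTRAIT OF A CLAY BLOW-UP (one name for the blow-up-limit rows that hold WITH the Clay
# force: ESS, Giga–Miura, KNSS 6.1, KNSS 6.2 mod (AX-L))

Cell `ns-blowup`, seat `ns-blowup-ecbridge-2` (g10; the E–C endpoint theory seat). LABEL: E–C typing
(KERNEL — no named fact; one conjunct conditional on the tree's conjecture
`AxisymmetricLiouvilleBoundedSwirl`, taken as a hypothesis inside that conjunct). WHAT THIS IS NOT: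
not Navier–Stokes evidence — necessary conditions on the TYPE `ClayBlowup ν` (no inhabitant is claimed
anywhere). Companion memo: `run/shared/lean/pub/ns-blowup/ecbridge2/ECBRIDGE-2-MEMO-9.md`.

g8's `ClayBlowup.portrait` (twelve rows) and g9's `ClayBlowup.forced_portrait` (seven vorticity /
strain / sup-rate rows) are the one-name citation points of the (C)-type checklist. This file adds the
third block — the rows obtained in g10 from THE ZOOM WITH FORCE (every zoom limit of a forced Clay
blow-up is an UNFORCED bounded ancient mild solution):

* `ClayBlowup.zoom_portrait (hν)` — (1) ESS: `‖u(t)‖_{L³}` unbounded as `t ↑ T`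
  (`limsup_eLpNorm_three_eq_top_forced`); (2) Giga–Miura: under Type I, no modulus of continuity
  for the vorticity direction on `{|ω| > d}` (`not_continuousAlignment_of_typeI_forced`); (3) for
  axisymmetric datum and force: no bound `r‖u‖ ≤ C` (KNSS Thm 6.1,
  `not_cylRadius_mul_norm_le_of_isAxisymmetric`) and (4) — IF `AxisymmetricLiouvilleBoundedSwirl` —
  not Type I in time (KNSS Thm 6.2 / Seregin–Šverák, `not_typeI_of_isAxisymmetric_forced_of_liouville`);
  `DesignedBlowup` twin and the (C)-reading.

References: Escauriaza–Seregin–Šverák 2003 Thm 1.3 [cite: EscauriazaSereginSverak2003, Thm. 1.3];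
Giga–Miura 2011 Thm 1.1 [cite: GigaMiura2011, Thm 1.1]; KNSS 2009 Thms 6.1–6.2
[cite: KochNadirashviliSereginSverak2009, Thms 6.1–6.2]; Fefferman (C) [cite: FeffermanClay2006, (C)].
-/

noncomputable section

namespace Summit.NavierStokesRegularity.FluidComputer

open Set MeasureTheory Filter Topology Function Metric
open scoped ENNReal NNReal
open Literature.Analysis Literature.Analysis.FluidPDE
open Summit.NavierStokesRegularity.NavierStokesRegularity

namespace ClayBlowup

variable {ν : ℝ} (X : ClayBlowup ν)

/-- **THE ZOOM PORTRAIT OF A CLAY BLOW-UP** (`ν > 0`, ANY Clay force; no named fact): (1) ESS —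
`‖u(t)‖_{L³}` exceeds every bound on every final interval; (2) Giga–Miura — a Type I blow-up breaks
every modulus of continuity of the vorticity direction above every threshold; (3) KNSS Thm 6.1 — with
axisymmetric datum and force, `r‖u‖` is unbounded; (4) KNSS Thm 6.2 / Seregin–Šverák — with
axisymmetric datum and force, and GRANTED KNSS's axisymmetric Liouville conjecture (AX-L), the blow-up
is not Type I in time. Cite this one name for the blow-up-limit checklist WITH the force.
[cite: EscauriazaSereginSverak2003, Thm. 1.3] [cite: GigaMiura2011, Thm 1.1]
[cite: KochNadirashviliSereginSverak2009, Thms 6.1–6.2] -/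
theorem zoom_portrait (hν : 0 < ν) :
    (∀ M : ℝ≥0, ∀ t₀ < X.T, ∃ t ∈ Ioo t₀ X.T, 0 ≤ t ∧ (M : ℝ≥0∞) < eLpNorm (X.u t) 3 volume) ∧
    (IsTypeIBlowup X.u X.T → ∀ d : ℝ, 0 < d → ∀ η : ℝ → ℝ, MonotoneOn η (Ici 0) →
      ContinuousOn η (Ici 0) → η 0 = 0 →
      ∃ t ∈ Ioo 0 X.T, ∃ x y : EuclideanSpace ℝ (Fin 3),
        d < ‖curl (X.u t) x‖ ∧ d < ‖curl (X.u t) y‖ ∧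
          η ‖x - y‖ <
            ‖vorticityDirection (curl (X.u t)) x - vorticityDirection (curl (X.u t)) y‖) ∧
    (IsAxisymmetric (X.u 0) → (∀ t ∈ Ico 0 X.T, IsAxisymmetric (X.f t)) →
      ¬ ∃ C : ℝ, ∀ t ∈ Ico 0 X.T, ∀ x : EuclideanSpace ℝ (Fin 3), cylRadius x * ‖X.u t x‖ ≤ C) ∧
    (IsAxisymmetric (X.u 0) → (∀ t ∈ Ico 0 X.T, IsAxisymmetric (X.f t)) →
      Summit.NavierStokesRegularity.NavierStokesRegularity.AxisymmetricLiouvilleBoundedSwirl →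
        ¬ IsTypeIBlowup X.u X.T) :=
  ⟨fun M _ ht₀ => X.limsup_eLpNorm_three_eq_top_forced hν M ht₀,
    fun hI _ hd _ hηm hηc hη0 => X.not_continuousAlignment_of_typeI_forced hν hI hd hηm hηc hη0,
    fun h0A hfA => X.not_cylRadius_mul_norm_le_of_isAxisymmetric hν h0A hfA,
    fun h0A hfA hL => X.not_typeI_of_isAxisymmetric_forced_of_liouville hν h0A hfA hL⟩

end ClayBlowup

/-- **The zoom portrait of a designed blow-up** (through `toClayBlowup`).
[cite: EscauriazaSereginSverak2003, Thm. 1.3] [cite: GigaMiura2011, Thm 1.1] -/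
theorem DesignedBlowup.zoom_portrait {ν : ℝ} (D : DesignedBlowup ν) (hν : 0 < ν) :
    (∀ M : ℝ≥0, ∀ t₀ < D.T, ∃ t ∈ Ioo t₀ D.T, 0 ≤ t ∧ (M : ℝ≥0∞) < eLpNorm (D.u t) 3 volume) ∧
    (IsTypeIBlowup D.u D.T → ∀ d : ℝ, 0 < d → ∀ η : ℝ → ℝ, MonotoneOn η (Ici 0) →
      ContinuousOn η (Ici 0) → η 0 = 0 →
      ∃ t ∈ Ioo 0 D.T, ∃ x y : EuclideanSpace ℝ (Fin 3),
        d < ‖curl (D.u t) x‖ ∧ d < ‖curl (D.u t) y‖ ∧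
          η ‖x - y‖ <
            ‖vorticityDirection (curl (D.u t)) x - vorticityDirection (curl (D.u t)) y‖) ∧
    (IsAxisymmetric (D.u 0) → (∀ t ∈ Ico 0 D.T, IsAxisymmetric (D.f t)) →
      ¬ ∃ C : ℝ, ∀ t ∈ Ico 0 D.T, ∀ x : EuclideanSpace ℝ (Fin 3), cylRadius x * ‖D.u t x‖ ≤ C) ∧
    (IsAxisymmetric (D.u 0) → (∀ t ∈ Ico 0 D.T, IsAxisymmetric (D.f t)) →
      Summit.NavierStokesRegularity.NavierStokesRegularity.AxisymmetricLiouvilleBoundedSwirl →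
        ¬ IsTypeIBlowup D.u D.T) :=
  D.toClayBlowup.zoom_portrait hν

/-- **Every breakdown scenario for (C) satisfies the zoom portrait** (no named fact).
[cite: FeffermanClay2006, (C)] [cite: EscauriazaSereginSverak2003, Thm. 1.3] -/
theorem clayBlowup_zoom_portrait_of_navierStokesBreakdownR3
    (h : Summit.NavierStokesRegularity.NavierStokesRegularity.NavierStokesBreakdownR3)
    {ν : ℝ} (hν : 0 < ν) :
    ∃ X : ClayBlowup ν,
      (∀ M : ℝ≥0, ∀ t₀ < X.T, ∃ t ∈ Ioo t₀ X.T, 0 ≤ t ∧ (M : ℝ≥0∞) < eLpNorm (X.u t) 3 volume) ∧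
      (IsTypeIBlowup X.u X.T → ∀ d : ℝ, 0 < d → ∀ η : ℝ → ℝ, MonotoneOn η (Ici 0) →
        ContinuousOn η (Ici 0) → η 0 = 0 →
        ∃ t ∈ Ioo 0 X.T, ∃ x y : EuclideanSpace ℝ (Fin 3),
          d < ‖curl (X.u t) x‖ ∧ d < ‖curl (X.u t) y‖ ∧
            η ‖x - y‖ <
              ‖vorticityDirection (curl (X.u t)) x - vorticityDirection (curl (X.u t)) y‖) ∧
      (IsAxisymmetric (X.u 0) → (∀ t ∈ Ico 0 X.T, IsAxisymmetric (X.f t)) →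
        ¬ ∃ C : ℝ, ∀ t ∈ Ico 0 X.T, ∀ x : EuclideanSpace ℝ (Fin 3),
          cylRadius x * ‖X.u t x‖ ≤ C) ∧
      (IsAxisymmetric (X.u 0) → (∀ t ∈ Ico 0 X.T, IsAxisymmetric (X.f t)) →
        Summit.NavierStokesRegularity.NavierStokesRegularity.AxisymmetricLiouvilleBoundedSwirl →
          ¬ IsTypeIBlowup X.u X.T) := by
  obtain ⟨X⟩ := forall_nonempty_clayBlowup_of_breakdownR3 h ν hν
  exact ⟨X, X.zoom_portrait hν⟩

end Summit.NavierStokesRegularity.FluidComputer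

end
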